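import Mathlib
import HarnessLib
import Summits.CriticalPhenomena.CardyFormulaZ2.Theses.CardyBoundaryCoulombGas

/-!
# Sketch — crux idea `translation-pinned-density` for HalfPlaneMarkDensityLaw (stmt-CriticalPhenomena-5661)

First-lemma signatures only (crux-ideate stage; nothing is proved here).
Lever: exact invariance of bond percolation on `ℤ × ℕ` under the boundary translation `(1,0)`
turns a one-site move of the density point into one-site moves of the three marks; each costs a
boundary two-arm event at the mark AND at the density point, in disjoint half-boxes, hence
`|m_n(k+1) - m_n(k)| ≤ C / n²`.  The lattice mark density is therefore Lipschitz at scale `1/n²`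
and the pointwise density law is EQUIVALENT to the integrated (collinear half-plane Cardy) law.
-/

namespace Summit.CriticalPhenomena.CardyFormulaZ2.Cruxes.HalfPlaneMarkDensityLaw.TranslationPinned

open Literature.Probability.Percolation Literature.Probability.LatticeModels
open Literature.Probability.RandomPlanarGeometry

/-- The closed upper half-lattice `ℤ × ℕ` (the crux's `{v | 0 ≤ v 1}`). -/
def hp : Set (Site 2) := {v : Site 2 | 0 ≤ v 1}

/-- The boundary arc `[A, B] × {0}`. -/
def arc (A B : ℤ) : Set (Site 2) := {v : Site 2 | v 1 = 0 ∧ A ≤ v 0 ∧ v 0 ≤ B}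

/-- The half-open boundary arc `[C, k) × {0}` (the crux's excluded set). -/
def arcO (C k : ℤ) : Set (Site 2) := {v : Site 2 | v 1 = 0 ∧ C ≤ v 0 ∧ v 0 < k}

/-- Lattice mark density: `P_{1/2}[(k,0) is the leftmost vertex of [C,∞) × {0} joined inside
`ℤ × ℕ` to the arc [A,B] × {0}]` — literally the event of the crux with integer marks. -/
noncomputable def markDensity (A B C k : ℤ) : ℝ :=
  (bondPercolation (zdGraph 2) half).real
    (openCrossing hp (arc A B) {![k, 0]} \ openCrossing hp (arc A B) (arcO C k))

/-- Collinear half-plane arc-to-arc crossing probability `P_{1/2}[[A,B] ↔ [C,D] in ℤ × ℕ]`. -/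
noncomputable def arcArc (A B C D : ℤ) : ℝ :=
  (bondPercolation (zdGraph 2) half).real (openCrossing hp (arc A B) (arc C D))

/-- Exact Russo/telescoping identity in the position of the fourth mark (set identity
`{[A,B] ↔ [C,k]} = {[A,B] ↔ [C,k-1]} ⊔ {k leftmost}`); provable now. -/
def Telescoping : Prop :=
  ∀ A B C k : ℤ, C < k → arcArc A B C k - arcArc A B C (k - 1) = markDensity A B C k

/-- Boundary two-arm event at the boundary vertex `(k,0)` out to sup-distance `R`, in primal
form: `(k,0)` is joined inside the half-box `Λ⁺_R(k) = [k-R,k+R] × [0,R]` to its outer boundary,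
while no vertex of `[k-R, k-1] × {0}` is joined to `(k,0)` inside `Λ⁺_R(k)` (planar duality then
gives the closed dual arm from the dual boundary point left of `k` to the outer boundary). -/
def twoArmAt (k : ℤ) (R : ℕ) : Set (BondConfig (Site 2)) :=
  openCrossing {v : Site 2 | 0 ≤ v 1 ∧ v 1 ≤ R ∧ k - R ≤ v 0 ∧ v 0 ≤ k + R} {![k, 0]}
      {v : Site 2 | (0 ≤ v 1 ∧ v 1 ≤ R ∧ (v 0 = k - R ∨ v 0 = k + R)) ∨
        (v 1 = R ∧ k - R ≤ v 0 ∧ v 0 ≤ k + R)}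
    \ openCrossing {v : Site 2 | 0 ≤ v 1 ∧ v 1 ≤ R ∧ k - R ≤ v 0 ∧ v 0 ≤ k + R}
        {v : Site 2 | v 1 = 0 ∧ k - R ≤ v 0 ∧ v 0 ≤ k - 1} {![k, 0]}

/-- Mirror image of `twoArmAt`: `(k,0)` joined inside the half-box to its outer boundary and to no
vertex of `[k+1, k+R] × {0}` (right-isolated). Equal in probability to `twoArmAt` by `v 0 ↦ -v 0`. -/
def twoArmRightAt (k : ℤ) (R : ℕ) : Set (BondConfig (Site 2)) :=
  openCrossing {v : Site 2 | 0 ≤ v 1 ∧ v 1 ≤ R ∧ k - R ≤ v 0 ∧ v 0 ≤ k + R} {![k, 0]}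
      {v : Site 2 | (0 ≤ v 1 ∧ v 1 ≤ R ∧ (v 0 = k - R ∨ v 0 = k + R)) ∨
        (v 1 = R ∧ k - R ≤ v 0 ∧ v 0 ≤ k + R)}
    \ openCrossing {v : Site 2 | 0 ≤ v 1 ∧ v 1 ≤ R ∧ k - R ≤ v 0 ∧ v 0 ≤ k + R}
        {v : Site 2 | v 1 = 0 ∧ k + 1 ≤ v 0 ∧ v 0 ≤ k + R} {![k, 0]}

/-- The crux's event with integer marks: `(k,0)` is the leftmost vertex of `[γ,∞) × {0}` joined in
`ℤ × ℕ` to `[α,β] × {0}`. -/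
def leftmostEvent (α β γ k : ℤ) : Set (BondConfig (Site 2)) :=
  openCrossing hp (arc α β) {![k, 0]} \ openCrossing hp (arc α β) (arcO γ k)

/-- COMBINATORIAL CORE of the lever (deterministic, configuration-wise; proved by a four-case
analysis in the idea card, checked by kit job j008107): moving the three marks one site to the left
changes the leftmost-event only on configurations with a boundary two-arm (isolation) event at the
density point `k` AND at one mark end, in disjoint half-boxes of radius `R`. -/
def ShiftSymmDiffInclusion : Prop :=
  ∀ (α β γ k : ℤ) (R : ℕ), 1 ≤ R → (R : ℤ) ≤ β - α + 1 → (R : ℤ) + 2 ≤ γ - β →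
    2 * (R : ℤ) + 1 ≤ k - γ →
      symmDiff (leftmostEvent α β γ k) (leftmostEvent (α - 1) (β - 1) (γ - 1) k) ⊆
        twoArmAt k R ∩ (twoArmAt β R ∪ twoArmRightAt (α - 1) R ∪ twoArmRightAt (γ - 1) R)

/-- Exact translation invariance along the boundary (the symmetry the lever rests on; provable now
from the invariance of `bondPercolation (zdGraph 2) half` under the graph automorphism `v ↦ v + e₀`). -/
def ShiftInvariance : Prop :=
  ∀ α β γ k : ℤ, markDensity α β γ (k + 1) = markDensity (α - 1) (β - 1) (γ - 1) k

/-- Stub A (provable now, M): Werner's exercise / Nolin Thm 24(i) for BOND `ℤ²` in point form —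
the half-plane two-arm probability from a boundary vertex is `O(1/R)` (tree has the site-`𝕋`
version `real_hpGood_le_div`; inputs: RSW on `ℤ²`, Harris–FKG, BK/Reimer, planarity). -/
def ZdHalfPlaneTwoArmPoint : Prop :=
  ∃ C : ℝ, ∀ (k : ℤ) (R : ℕ), 1 ≤ R →
    (bondPercolation (zdGraph 2) half).real (twoArmAt k R) ≤ C / R

/-- Stub B = FIRST LEMMA of the line (provable now from Stub A + translation invariance +
independence of disjoint half-boxes): the lattice mark density is Lipschitz at scale `n⁻²` on
compact windows of `(c, ∞)`. -/
def BoundaryShiftLipschitz : Prop :=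
  ∀ a b c x₀ x₁ : ℝ, a < b → b < c → c < x₀ → x₀ < x₁ →
    ∃ C : ℝ, ∀ n : ℕ, 1 ≤ n → ∀ k k' : ℤ, ⌊x₀ * n⌋ ≤ k → k ≤ k' → k' ≤ ⌊x₁ * n⌋ →
      |markDensity ⌊a * n⌋ ⌊b * n⌋ ⌊c * n⌋ k' - markDensity ⌊a * n⌋ ⌊b * n⌋ ⌊c * n⌋ k|
        ≤ C * (k' - k) / (n : ℝ) ^ 2

/-- Transfer target `C⁺` (HalfPlaneCollinearCardy): Cardy's formula for bond-`ℤ²` in the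
half-plane with four collinear marks — the integrated law; follows from `RectilinearCardy`
restricted to the boxes `[-Rn,Rn] × [0,Rn]` (marks on the bottom side) by RSW truncation. -/
def HalfPlaneCollinearCardy : Prop :=
  ∀ a b c x : ℝ, a < b → b < c → c < x →
    Filter.Tendsto (fun n : ℕ ↦ arcArc ⌊a * n⌋ ⌊b * n⌋ ⌊c * n⌋ ⌊x * n⌋) Filter.atTop
      (nhds (cardyFunction (crossRatio ![a, b, c, x])))

/-- Stub D (pure real analysis, provable now): a difference-quotient lemma. If the partial sums
of `g n` over lattice windows converge to increments of `G`, `g n` is Lipschitz at scale `n⁻²`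
near `x`, and `G` is differentiable at `x`, then `n · g n ⌊x n⌋ → G'(x)`. -/
def DensityFromIncrements : Prop :=
  ∀ (g : ℕ → ℤ → ℝ) (G : ℝ → ℝ) (x ρ δ₀ C : ℝ), 0 < δ₀ →
    (∀ y : ℝ, x - δ₀ < y → y < x + δ₀ → x ≤ y →
      Filter.Tendsto (fun n : ℕ ↦ ∑ k ∈ Finset.Ioc ⌊x * n⌋ ⌊y * n⌋, g n k) Filter.atTop
        (nhds (G y - G x))) →
    (∀ y : ℝ, x - δ₀ < y → y ≤ x →
      Filter.Tendsto (fun n : ℕ ↦ ∑ k ∈ Finset.Ioc ⌊y * n⌋ ⌊x * n⌋, g n k) Filter.atTop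
        (nhds (G x - G y))) →
    (∀ n : ℕ, 1 ≤ n → ∀ k k' : ℤ, ⌊(x - δ₀) * n⌋ ≤ k → k ≤ k' → k' ≤ ⌊(x + δ₀) * n⌋ →
      |g n k' - g n k| ≤ C * (k' - k) / (n : ℝ) ^ 2) →
    HasDerivAt G ρ x →
    Filter.Tendsto (fun n : ℕ ↦ (n : ℝ) * g n ⌊x * n⌋) Filter.atTop (nhds ρ)

/-- The composition the line proposes (statement; the crux BY NAME). -/
def Reduction : Prop :=
  Telescoping → BoundaryShiftLipschitz → DensityFromIncrements → HalfPlaneCollinearCardy →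
    Summit.CriticalPhenomena.CardyFormulaZ2.Theses.CardyBoundaryCoulombGas.HalfPlaneMarkDensityLaw

/-- Sanity: the crux's event is literally `markDensity` with floor-scaled marks. -/
example (a b c x : ℝ) (n : ℕ) :
    markDensity ⌊a * n⌋ ⌊b * n⌋ ⌊c * n⌋ ⌊x * n⌋ =
      (bondPercolation (zdGraph 2) half).real
        (openCrossing {v : Site 2 | 0 ≤ v 1} {v | v 1 = 0 ∧ ⌊a * n⌋ ≤ v 0 ∧ v 0 ≤ ⌊b * n⌋}
            {![⌊x * n⌋, 0]} \
          openCrossing {v : Site 2 | 0 ≤ v 1} {v | v 1 = 0 ∧ ⌊a * n⌋ ≤ v 0 ∧ v 0 ≤ ⌊b * n⌋}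
            {v | v 1 = 0 ∧ ⌊c * n⌋ ≤ v 0 ∧ v 0 < ⌊x * n⌋}) := rfl

end Summit.CriticalPhenomena.CardyFormulaZ2.Cruxes.HalfPlaneMarkDensityLaw.TranslationPinned
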